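import Summits.AtomisticToContinuum.Crystallization.Theses.PerronTransitivity
import Literature.MathematicalPhysics.StatisticalMechanics.CrystallizationSymmetries
import Literature.MathematicalPhysics.StatisticalMechanics.BarlowStacking
import Summits.AtomisticToContinuum.Crystallization.Theorems.PerronTransitivityUniformBindingRigidityPeriodicLeast
import Summits.AtomisticToContinuum.Crystallization.Theorems.PerronTransitivityUniformBindingRigidityStackingLock
import Summits.AtomisticToContinuum.Crystallization.Theorems.PerronTransitivityUniformBindingRigidityCohesionH

/-!
# Uniform binding rigidity (`M*`): the route-level split into a half-space core and a Barlow chart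

Glue file (`--supports stmt-AtomisticToContinuum-15099`) for the crux-strategist's DECOMPOSITION of the
crux `Summit.AtomisticToContinuum.Crystallization.Theses.PerronTransitivity.UniformBindingRigidity`
(`M*`, item stmt-AtomisticToContinuum-15099, route `route-AtomisticToContinuum-PerronTransitivity`) into
the two children recommended by both lead provers (`Cruxes/UniformBindingRigidity/LEAD-c1.md`,
`LEAD-c2.md`) and carried by the registered skeleton `Cruxes/UniformBindingRigidity/Lines/birth.lean`
(rev 3/4):

* `UniformBindingHalfSpaceCore` — the `e*`-FREE HALF-SPACE CORE `(CORE)`: no `1/4`-separated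
  `Y ⊆ ℝ³` through `0`, contained in the closed half-space `{⟪·, u⟫ ≤ 0}` (`‖u‖ = 1`) and with points at
  every depth, has all its Lennard-Jones site sums `U_Y(p) = Σ'_{q ∈ Y, q ≠ p} V_LJ(dist p q) ≤ −711/500`
  (the kernel-certified level `2e* ≤ −711/500`, `two_mul_iInf_le`, part I);
* `UniformBindingIsBarlow` — the BARLOW CHART: a non-empty, uniformly discrete, relatively dense
  `X ⊆ ℝ³` all of whose site sums are `≤ 2e*` (`e* = ⨅_Q e(Q)` over periodic configurations) is a
  rigid-motion image of a Barlow stacking `barlowStacking a h s` (`s` a Hägg sequence) with `(a, h)` in the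
  registry box `47/50 ≤ a ≤ 1`, `39a/50 ≤ h ≤ 17a/20`.

The single theorem `UniformBindingRigidity_of_subs : (CORE) → (CHART) → UniformBindingRigidity` is the
glue `M* ⇐ (CORE) ∧ (CHART)`; it only composes LANDED theorems:
`noThickHalfSpaceBinding_of_core_rung` (part VIII, p150231: `(CORE)` ⇒ no thick half-space binding at
level `2e*`), `cohesion_of_noThickHalfSpaceBinding` (part VII, p146119: ⇒ every non-empty uniformly
discrete uniformly `2e*`-bound `X` is relatively dense), the chart, `stub_stackingLock` (p143502: uniform
`2e*`-binding of a Barlow stacking in the box forces the alternating Hägg sequence, hence period `2`),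
`barlowPeriodicConfiguration` (Literature: a Barlow stacking with periodic Hägg sequence is a periodic
configuration) and `stub_periodicLeast` (p143410: a uniformly `2e*`-bound periodic configuration attains
`e*`).  The binder types below are the two children VERBATIM (as filed with
`ledger route edit … --split UniformBindingRigidity`), and the conclusion is the crux BY NAME.  [folklore]
-/

noncomputable section

namespace Summit.AtomisticToContinuum.Crystallization.Theorems.PerronTransitivityUniformBindingRigidity

open Literature.MathematicalPhysics.StatisticalMechanics

/-- **GLUE `M* ⇐ (CORE) ∧ (CHART)`.**  The `e*`-free half-space core and the Barlow chart together
imply uniform binding rigidity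
`Summit.AtomisticToContinuum.Crystallization.Theses.PerronTransitivity.UniformBindingRigidity`:
given a non-empty uniformly discrete uniformly `2e*`-bound `X`, the core (through parts I–VIII of the
cohesion helpers) makes `X` relatively dense, the chart makes it a rigid image of a Barlow stacking in the
box, the landed stacking lock makes the Hägg sequence alternating (period `2`), so `X` is the point set of
a periodic configuration, and the landed least-element lemma shows that this configuration attains
`e* = min e`. [folklore] -/
theorem UniformBindingRigidity_of_subs
    (hCore : ∀ (Y : Set (EuclideanSpace ℝ (Fin 3))) (u : EuclideanSpace ℝ (Fin 3)), ‖u‖ = 1 →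
      (0 : EuclideanSpace ℝ (Fin 3)) ∈ Y →
      (∀ p ∈ Y, ∀ q ∈ Y, p ≠ q → 1 / 4 ≤ dist p q) →
      (∀ q ∈ Y, inner ℝ q u ≤ 0) →
      (∀ t : ℝ, ∃ q ∈ Y, inner ℝ q u < -t) →
      (∀ p ∈ Y, ∑' q : {q : EuclideanSpace ℝ (Fin 3) // q ∈ Y ∧ q ≠ p},
          Literature.MathematicalPhysics.StatisticalMechanics.lennardJones (dist p q.1) ≤ -(711 / 500)) →
      False)
    (hChart : ∀ X : Set (EuclideanSpace ℝ (Fin 3)), X.Nonempty →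
      (∃ δ : ℝ, 0 < δ ∧ ∀ p ∈ X, ∀ q ∈ X, p ≠ q → δ ≤ dist p q) →
      (∀ p ∈ X, ∑' q : {q : EuclideanSpace ℝ (Fin 3) // q ∈ X ∧ q ≠ p},
          Literature.MathematicalPhysics.StatisticalMechanics.lennardJones (dist p q.1) ≤
        2 * ⨅ Q : Literature.MathematicalPhysics.StatisticalMechanics.PeriodicConfiguration 3,
          Q.energyPerParticle Literature.MathematicalPhysics.StatisticalMechanics.lennardJones) →
      (∃ R : ℝ, ∀ y : EuclideanSpace ℝ (Fin 3), ∃ p ∈ X, dist y p ≤ R) →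
      ∃ a h : ℝ, 47 / 50 ≤ a ∧ a ≤ 1 ∧ 39 / 50 * a ≤ h ∧ h ≤ 17 / 20 * a ∧
        ∃ s : ℤ → ℤ, Literature.MathematicalPhysics.StatisticalMechanics.IsHaggSeq s ∧
          ∃ (A : EuclideanSpace ℝ (Fin 3) ≃ₗᵢ[ℝ] EuclideanSpace ℝ (Fin 3))
            (v : EuclideanSpace ℝ (Fin 3)),
            X = (fun z => A z + v) ''
              Literature.MathematicalPhysics.StatisticalMechanics.barlowStacking a h s) :
    Summit.AtomisticToContinuum.Crystallization.Theses.PerronTransitivity.UniformBindingRigidity := by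
  intro X hne hsep hU
  -- cohesion: `(CORE)` ⇒ `(NHB-thick)` (part VIII) ⇒ `X` relatively dense (part VII)
  have hcoh : ∃ R : ℝ, ∀ y : EuclideanSpace ℝ (Fin 3), ∃ p ∈ X, dist y p ≤ R :=
    cohesion_of_noThickHalfSpaceBinding (noThickHalfSpaceBinding_of_core_rung hCore) X hne hsep hU
  -- the chart: `X` is a rigid image of a Barlow stacking in the box
  obtain ⟨a, h, ha1, ha2, hh1, hh2, s, hs, A, v, rfl⟩ := hChart X hne hsep hU hcoh
  -- the landed stacking lock: the Hägg sequence alternates, hence has period `2`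
  have halt : ∀ m : ℤ, s (m + 1) = -s m := stub_stackingLock a h s A v ha1 ha2 hh1 hh2 hs hU
  have hs2 : ∀ i : ℤ, s (i + 2) = s i := fun i => by
    rw [show i + 2 = i + 1 + 1 by ring, halt, halt, neg_neg]
  have ha0 : 0 < a := lt_of_lt_of_le (by norm_num) ha1
  have hh0 : 0 < h := lt_of_lt_of_le (by positivity) hh1
  -- so `X` is the point set of a periodic configuration (Literature: `barlowPeriodicConfiguration`)
  have hP : (((barlowPeriodicConfiguration s ha0.ne' hh0.ne' two_ne_zero hs2).isometryImage A).translate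
      v).points = (fun z => A z + v) '' barlowStacking a h s := by
    ext z
    rw [PeriodicConfiguration.mem_points_translate, PeriodicConfiguration.mem_points_isometryImage,
      barlowPeriodicConfiguration_points, Set.mem_image]
    constructor
    · intro hz
      exact ⟨A.symm (z - v), hz, by simp⟩
    · rintro ⟨w, hw, rfl⟩
      simpa using hw
  -- the landed least-element lemma: a uniformly `2e*`-bound periodic configuration attains `e*`
  exact ⟨_, hP, stub_periodicLeast _ (hP ▸ hU)⟩

end Summit.AtomisticToContinuum.Crystallization.Theorems.PerronTransitivityUniformBindingRigidity

end
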